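import Literature.AlgebraicGeometry.Resolution.WeightedCentreBendingWitness
import HarnessLib

/-!
# The third rung of the bending ladder: `max W(x^{p³} + y^p + y^{p+1}) = (p, p³ + p² + p + 1)`

[ATW24] Abramovich–Temkin–Włodarczyk, *Functorial embedded resolution via weighted blowings up*,
Algebra & Number Theory 18 (2024), §5.1 (p. 1575), Thm. 5.3.1 (2)–(3) (p. 1578), Lemma 5.2.6 (p. 1576).
[CJS20] Cossart–Jannsen–Saito, *Desingularization: Invariants and Strategy*, LNM 2270 (2020), Def. 8.1 (3) /
Def. 8.2 (1) (pp. 117–118: `δ(f; u; y)`), Def. 8.8 / Thm. 8.16 (pp. 119–121: vertex preparation `y ↦ y + λ u^A`).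
[Hau10] Hauser, Bull. AMS 47 (2010), §C (p. 9: failure of maximal contact) and §D (p. 12: kangaroo points).
[HP19b] Hauser–Perlega, Publ. RIMS 60 (2024), §7 (p. 798: the residual order of `z^{p^e} + F`).

## What is proved (the polynomial `W(f)` model of `WeightedCentreInvariantSet`; `char k = p`; `x = X 0`, `y = X 1`)

A two-variable VERTEX BOUND packaged once and for all (any field):
* `isDeltaPrepared_of_hironakaDelta_eq_div` — if `δ(G; x; y) = K/ν` with `ν ∤ K` then `G` is `δ`-prepared (no lattice
  vertex lies on the `δ`-face);
* `not_lt_of_mem_admissibleInvariants_of_vertex₂` — if `ord G = ν`, `in_ν(G) = y^ν`, `δ(G; x; y) = K/ν` and `G` is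
  `δ`-prepared, then NO invariant of `W(G)` exceeds `(ν, K)` (the tree's vertex theorem
  `succ_card_le_countP_exps_of_isDeltaPrepared` with `S = {y}`, plus the head argument for weights `> 1/ν`).

The third rung (`e = 3`, `r = 1`) of the observatory's bending ladder, for every prime `p`:
* `bentForm₃`, `addPolyShear_symm_bending₃` — `F = x^{p³} + y^p + y^{p+1}` after `y ↦ y − (x^{p²} + x^{p²+p} + x^{p²+p+1})`
  is the explicit fifteen-term `G = y^p + y^{p+1} − (x^{p²} + x^{p²+p} + x^{p²+p+1}) y^p − (x^{p³} + x^{p³+p²} + x^{p³+p²+p}) y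
  + x^{K} + x^{p³+2p²} + 2x^{p³+2p²+p} + x^{p³+2p²+p+1} + x^{p³+2p²+2p} + x^{p³+2p²+2p+1}`, `K = p³ + p² + p + 1` (two Frobenius
  cancellations: `x^{p³}` against `γ^p`, then `x^{p³+p²} + x^{p³+p²+p}` against `γ^{p+1}`);
* `isCentreFor_bending₃`, `bending₃_mem_admissibleInvariants` — **`(p, p³+p²+p+1) ∈ W(F)`** (weights `1/p`, `1/K`);
* `monomialOrd_bentForm₃` (`ord = p`), `homogeneousComponent_bentForm₃` (`in_p = y^p`), **`hironakaDelta_bentForm₃`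
  (`δ = K/p`, attained only at the vertex `x^K`)**, hence (`p ∤ K`) `δ`-prepared;
* **`isMaxInv_bending₃` — `max W(x^{p³} + y^p + y^{p+1}) = (p, p³ + p² + p + 1)`**, and in characteristic `2`
  **`isMaxInv_bending₃_two` — `max W(x⁸ + y² + y³) = (2, 15)`**.

With `WeightedCentreInseparableSplit` (`e = 1`: `(p, p + 1)`) and `WeightedCentreBendingWitness` (`e = 2`:
`(p, p² + p + 1)`) this types the first three rungs `(p, (p^{e+1} − 1)/(p − 1))` of the observatory's bending ladder
(engine 1, Thm. H with `r = 1`).  Value type: typed theorems in the polynomial `W(f)` model — not a resolution theorem.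
-/

noncomputable section

open MvPolynomial

namespace Literature.AlgebraicGeometry.Resolution

namespace WeightedBlowup

variable {k : Type*} [Field k]

/-! ## §1 Plumbing (two variables) -/

/-- The inverse shear on the sheared variable (plumbing). [folklore] -/
private theorem addPolyShear_symm_X_self₂₀ {σ : Type*} [DecidableEq σ] (a : σ) (q : MvPolynomial σ k) :
    (addPolyShear a q).symm (X a) = X a - killVar a q := by
  simp [addPolyShear, sub_eq_add_neg]

/-- The inverse shear fixes the other variables (plumbing). [folklore] -/
private theorem addPolyShear_symm_X_of_ne₂₀ {σ : Type*} [DecidableEq σ] (a : σ) (q : MvPolynomial σ k) {x : σ}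
    (hx : x ≠ a) : (addPolyShear a q).symm (X x) = X x := by
  simp [addPolyShear, hx]

/-- `ν_w(x^i y^j) = i·w₀ + j·w₁` (plumbing). [cite: AbramovichTemkinWlodarczyk2024, Rem. 2.4.2 (p. 1568)] -/
private theorem monomialOrd_X_pow_mul_X_pow₂₀ (w : Fin 2 → ℕ) (i j : ℕ) :
    monomialOrd w (X 0 ^ i * X 1 ^ j : MvPolynomial (Fin 2) k) = ((i * w 0 + j * w 1 : ℕ) : ℕ∞) := by
  rw [monomialOrd_mul, X_pow_eq_monomial, X_pow_eq_monomial, monomialOrd_monomial w _ one_ne_zero,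
    monomialOrd_monomial w _ one_ne_zero, Finsupp.weight_single, Finsupp.weight_single, smul_eq_mul, smul_eq_mul,
    Nat.cast_add]

/-- `ν_w(x_a^i) = i·w_a` (plumbing). [cite: AbramovichTemkinWlodarczyk2024, Rem. 2.4.2 (p. 1568)] -/
private theorem monomialOrd_X_pow₂₀ (w : Fin 2 → ℕ) (a : Fin 2) (i : ℕ) :
    monomialOrd w (X a ^ i : MvPolynomial (Fin 2) k) = ((i * w a : ℕ) : ℕ∞) := by
  rw [X_pow_eq_monomial, monomialOrd_monomial w _ one_ne_zero, Finsupp.weight_single, smul_eq_mul]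

/-- `ν_w(−F) = ν_w(F)` (plumbing). [cite: AbramovichTemkinWlodarczyk2024, Rem. 5.2.3] -/
private theorem monomialOrd_neg₂₀ {σ : Type*} (w : σ → ℕ) (F : MvPolynomial σ k) :
    monomialOrd w (-F) = monomialOrd w F := by
  rw [show -F = C (-1 : k) * F by rw [C_neg, C_1, neg_one_mul]]
  exact monomialOrd_mul_of_constantCoeff_ne_zero w (by rw [constantCoeff_C]; exact neg_ne_zero.2 one_ne_zero) F

/-- `n ≤ ν(A)`, `n ≤ ν(B)` ⟹ `n ≤ ν(A + B)` (plumbing). [cite: AbramovichTemkinWlodarczyk2024, Lemma 5.2.6] -/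
private theorem le_monomialOrd_add₂₀ {σ : Type*} (w : σ → ℕ) {A B : MvPolynomial σ k} {n : ℕ∞}
    (hA : n ≤ monomialOrd w A) (hB : n ≤ monomialOrd w B) : n ≤ monomialOrd w (A + B) :=
  le_trans (le_min hA hB) (min_monomialOrd_le_add w A B)

/-- `n ≤ ν(A)`, `n ≤ ν(B)` ⟹ `n ≤ ν(A − B)` (plumbing). [cite: AbramovichTemkinWlodarczyk2024, Lemma 5.2.6] -/
private theorem le_monomialOrd_sub₂₀ {σ : Type*} (w : σ → ℕ) {A B : MvPolynomial σ k} {n : ℕ∞}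
    (hA : n ≤ monomialOrd w A) (hB : n ≤ monomialOrd w B) : n ≤ monomialOrd w (A - B) := by
  rw [sub_eq_add_neg]
  exact le_monomialOrd_add₂₀ w hA (by rwa [monomialOrd_neg₂₀])

/-- Coefficients of `x^i y^j` (plumbing). [folklore] -/
private theorem coeff_X_pow_mul_X_pow₂₀ (i j : ℕ) (d : Fin 2 →₀ ℕ) :
    coeff d (X 0 ^ i * X 1 ^ j : MvPolynomial (Fin 2) k) =
      if Finsupp.single (0 : Fin 2) i + Finsupp.single 1 j = d then 1 else 0 := by
  classical
  rw [X_pow_eq_monomial, X_pow_eq_monomial, monomial_mul, mul_one, coeff_monomial]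

/-- The support of `x^i y^j` (plumbing). [folklore] -/
private theorem support_X_pow_mul_X_pow₂₀ (i j : ℕ) :
    (X 0 ^ i * X 1 ^ j : MvPolynomial (Fin 2) k).support ⊆ {Finsupp.single (0 : Fin 2) i + Finsupp.single 1 j} := by
  classical
  rw [X_pow_eq_monomial, X_pow_eq_monomial, monomial_mul, mul_one]
  exact support_monomial_subset

/-- The exponent `(i, j)` evaluated (plumbing). [folklore] -/
private theorem e_apply_zero₂₀ (i j : ℕ) : (Finsupp.single (0 : Fin 2) i + Finsupp.single 1 j : Fin 2 →₀ ℕ) 0 = i := by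
  simp

/-- The exponent `(i, j)` evaluated (plumbing). [folklore] -/
private theorem e_apply_one₂₀ (i j : ℕ) : (Finsupp.single (0 : Fin 2) i + Finsupp.single 1 j : Fin 2 →₀ ℕ) 1 = j := by
  simp

/-- The total degree of the exponent `(i, j)` (plumbing). [folklore] -/
private theorem degree_e₂₀ (i j : ℕ) : (Finsupp.single (0 : Fin 2) i + Finsupp.single 1 j : Fin 2 →₀ ℕ).degree = i + j := by
  rw [map_add, Finsupp.degree_single, Finsupp.degree_single]

/-- Exponents `(i, j)` are determined by `i` and `j` (plumbing). [folklore] -/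
private theorem e_eq_e_iff₂₀ {i j i' j' : ℕ} :
    (Finsupp.single (0 : Fin 2) i + Finsupp.single 1 j : Fin 2 →₀ ℕ) = Finsupp.single 0 i' + Finsupp.single 1 j' ↔
      i = i' ∧ j = j' := by
  constructor
  · intro h
    have h0 := DFunLike.congr_fun h 0
    have h1 := DFunLike.congr_fun h 1
    rw [e_apply_zero₂₀, e_apply_zero₂₀] at h0
    rw [e_apply_one₂₀, e_apply_one₂₀] at h1
    exact ⟨h0, h1⟩
  · rintro ⟨rfl, rfl⟩
    rfl

/-- The head of a sorted list is its minimum (plumbing). [folklore] -/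
private theorem le_of_mem_of_pairwise₂₀ {c x : ℚ} {es : List ℚ} (hs : (c :: es).Pairwise (· ≤ ·))
    (hx : x ∈ c :: es) : c ≤ x := by
  rcases List.mem_cons.1 hx with rfl | hx
  · exact le_rfl
  · exact (List.pairwise_cons.1 hs).1 x hx

/-- An entry of the invariant (plumbing). [folklore] -/
private theorem inv_mem_exps₂₀ {N : ℕ} {γ : Fin N → ℚ} {x : Fin N} (hx : γ x ≠ 0) : (γ x)⁻¹ ∈ exps γ := by
  classical
  unfold exps
  rw [List.mem_insertionSort, List.mem_map]
  exact ⟨x, Finset.mem_toList.2 (Finset.mem_filter.2 ⟨Finset.mem_univ _, hx⟩), rfl⟩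

/-- The invariant of the two-weight centre `(1/a on y, 1/b on x)`, `a ≤ b` (plumbing). [folklore] -/
private theorem exps_singleWeights_add₂₀ {a b : ℕ} (ha : 0 < a) (hb : 0 < b) (hab : (a : ℚ) ≤ b) :
    exps (singleWeights (1 : Fin 2) a + singleWeights (0 : Fin 2) b) = [(a : ℚ), (b : ℚ)] := by
  classical
  have hdisj : ∀ x : Fin 2, singleWeights (1 : Fin 2) a x = 0 ∨ singleWeights (0 : Fin 2) b x = 0 := by
    intro x
    by_cases hx : x = 0
    · subst hx; left; simp [singleWeights]
    · right; simp [singleWeights, hx]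
  rw [exps_add_eq hdisj, exps_singleWeights 1 ha, exps_singleWeights 0 hb, List.singleton_append,
    List.insertionSort_cons, List.insertionSort_cons, List.insertionSort_nil, List.orderedInsert_nil,
    List.orderedInsert_cons_of_le _ _ hab]

/-- The scaled weights of the two-weight centre (plumbing). [folklore] -/
private theorem scaled_singleWeights_add₂₀ (a b : ℕ) (ha : 0 < a) (hb : 0 < b) :
    ∀ i : Fin 2, (((fun i : Fin 2 => if i = 0 then a else b) i : ℕ) : ℚ) =
      ((a * b : ℕ) : ℚ) * (singleWeights (1 : Fin 2) a + singleWeights (0 : Fin 2) b) i := by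
  have h10 : (1 : Fin 2) ≠ 0 := by decide
  have h01 : (0 : Fin 2) ≠ 1 := by decide
  have haq : (a : ℚ) ≠ 0 := by exact_mod_cast ha.ne'
  have hbq : (b : ℚ) ≠ 0 := by exact_mod_cast hb.ne'
  intro i
  fin_cases i
  · simp only [Fin.zero_eta, ↓reduceIte, Pi.add_apply, singleWeights, if_neg h01, zero_add, Nat.cast_mul]
    rw [mul_inv_cancel_right₀ hbq]
  · simp only [Fin.mk_one, if_neg h10, Pi.add_apply, singleWeights, ↓reduceIte, add_zero, Nat.cast_mul]
    rw [mul_comm ((a : ℕ) : ℚ), mul_inv_cancel_right₀ haq]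

/-! ## §2 The two-variable vertex bound -/

/-- **Vacuous `δ`-preparedness**: if `δ(G; x; y) = K/ν` and `ν ∤ K`, then no lattice point has `|A| = δ`, so `G` is
`δ`-prepared for `S = {y}`. (derived here) [cite: CossartJannsenSaito2020, Def. 8.8 / Thm. 8.16 (pp. 119–121)] -/
theorem isDeltaPrepared_of_hironakaDelta_eq_div {G : MvPolynomial (Fin 2) k} {ν K : ℕ} (hν : 0 < ν)
    (hδ : hironakaDelta ({1} : Finset (Fin 2)) ν G = ((((K : ℕ) : ℚ) / (ν : ℚ) : ℚ) : WithTop ℚ))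
    (hK : ¬ ν ∣ K) : IsDeltaPrepared ({1} : Finset (Fin 2)) ν G := by
  intro v _ hdeg
  exfalso
  have hνq : (ν : ℚ) ≠ 0 := by exact_mod_cast hν.ne'
  rw [hδ, WithTop.coe_eq_coe] at hdeg
  have h : ((v.degree * ν : ℕ) : ℚ) = ((K : ℕ) : ℚ) := by
    rw [Nat.cast_mul, hdeg, div_mul_cancel₀ _ hνq]
  have h' : v.degree * ν = K := by exact_mod_cast h
  exact hK ⟨v.degree, by rw [← h', mul_comm]⟩

/-- **The two-variable vertex bound.**  Let `G ∈ k[x, y]` have `ord G = ν`, `in_ν(G) = y^ν` (so `τ = 1` and the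
directrix is `{y = 0}`), `δ(G; x; y) = K/ν`, and let `G` be `δ`-prepared.  Then no invariant of a centre admissible for
`G` exceeds `(ν, K)`: a centre with a weight `> 1/ν` has leading entry `< ν`; otherwise the vertex theorem gives two
weights `≥ 1/K`, i.e. `b₁ = ν` and `b₂ ≤ K`. (derived here) [cite: CossartJannsenSaito2020, Thm. 8.16 (p. 121)]
[cite: AbramovichTemkinWlodarczyk2024, Thm. 5.1.1 / §5.3 (pp. 1575–1578)] -/
theorem not_lt_of_mem_admissibleInvariants_of_vertex₂ {G : MvPolynomial (Fin 2) k} {ν K : ℕ} (hν : 0 < ν)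
    (hord : monomialOrd (fun _ => 1) G = ν) (hin : homogeneousComponent ν G = X 1 ^ ν)
    (hδ : hironakaDelta ({1} : Finset (Fin 2)) ν G = ((((K : ℕ) : ℚ) / (ν : ℚ) : ℚ) : WithTop ℚ))
    (hprep : IsDeltaPrepared ({1} : Finset (Fin 2)) ν G) {c : List ℚ} (hc : c ∈ admissibleInvariants G) :
    ¬ ATW.TruncLex.lt [(ν : ℚ), (K : ℚ)] c := by
  classical
  obtain ⟨Ψ, γ, h, rfl⟩ := hc
  have he0 : (0 : ℚ) < ν := by exact_mod_cast hν
  have hτ1 : hironakaTau k {homogeneousComponent ν G} = 1 := by rw [hin, hironakaTau_X_pow 1 hν.ne']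
  have hτ : ({1} : Finset (Fin 2)).card = hironakaTau k {homogeneousComponent ν G} := by
    rw [hτ1, Finset.card_singleton]
  have hFS : ∀ d ∈ (homogeneousComponent ν G).support, ∀ j ∉ ({1} : Finset (Fin 2)), d j = 0 := by
    intro d hd j hj
    rw [hin, X_pow_eq_monomial] at hd
    have := Finset.mem_singleton.1 (support_monomial_subset hd)
    subst this
    exact Finsupp.single_eq_of_ne (fun h => hj (Finset.mem_singleton.2 h))
  have hs := exps_sorted γ
  by_cases hall : ∀ x, γ x ≤ (ν : ℚ)⁻¹
  · -- all weights `≤ 1/ν`: the vertex theorem applies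
    obtain ⟨es, hes⟩ : ∃ es, exps γ = (ν : ℚ) :: es := by
      obtain ⟨t, ht⟩ := replicate_prefix_of_forall_le hord h hall
      rw [hτ1, List.replicate_one] at ht
      exact ⟨t, ht.symm⟩
    have hcount := succ_card_le_countP_exps_of_isDeltaPrepared hord hτ hFS hprep hδ h hall
    rw [Finset.card_singleton, hes] at hcount
    have heδ : (ν : ℚ) * (((K : ℕ) : ℚ) / (ν : ℚ)) = (K : ℚ) := mul_div_cancel₀ _ he0.ne'
    rw [heδ] at hcount
    rw [hes]
    cases es with
    | nil =>
      exfalso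
      rw [List.countP_cons, List.countP_nil] at hcount
      split_ifs at hcount <;> omega
    | cons e₂ es' =>
      have hs₂ : (e₂ :: es').Pairwise (· ≤ ·) := by
        have := hs
        rw [hes] at this
        exact (List.pairwise_cons.1 this).2
      have hex : ∃ x ∈ e₂ :: es', x ≤ (K : ℚ) := by
        by_contra hne
        push Not at hne
        have h0 : (e₂ :: es').countP (fun x => decide (x ≤ (K : ℚ))) = 0 := by
          rw [List.countP_eq_zero]
          intro x hx
          simpa using hne x hx
        rw [List.countP_cons, h0] at hcount
        split_ifs at hcount <;> omega
      obtain ⟨x, hx, hxF⟩ := hex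
      have he₂ : e₂ ≤ (K : ℚ) := (le_of_mem_of_pairwise₂₀ hs₂ hx).trans hxF
      intro hlt
      rw [ATW.TruncLex.cons_lt_cons] at hlt
      rcases hlt with hlt | ⟨-, hlt⟩
      · exact lt_irrefl _ hlt
      · rw [ATW.TruncLex.cons_lt_cons] at hlt
        rcases hlt with hlt | ⟨hEq, hlt⟩
        · exact not_lt.2 he₂ hlt
        · exact ATW.TruncLex.not_nil_lt _ hlt
  · -- some weight exceeds `1/ν`: the leading invariant is `< ν`
    push Not at hall
    obtain ⟨x, hx⟩ := hall
    have hγx : 0 < γ x := (inv_pos.2 he0).trans hx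
    have hinv : (γ x)⁻¹ < ν := by
      have := inv_strictAnti₀ (inv_pos.2 he0) hx
      rwa [inv_inv] at this
    have hmem : (γ x)⁻¹ ∈ exps γ := inv_mem_exps₂₀ hγx.ne'
    intro hlt
    cases hγ : exps γ with
    | nil => rw [hγ] at hmem; simp at hmem
    | cons c₁ cs =>
      rw [hγ] at hmem hlt hs
      have hc₁ : c₁ < ν := (le_of_mem_of_pairwise₂₀ hs hmem).trans_lt hinv
      rw [ATW.TruncLex.cons_lt_cons] at hlt
      rcases hlt with hlt | ⟨hEq, -⟩
      · exact lt_asymm hlt hc₁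
      · exact hc₁.ne' hEq

/-! ## §3 The bent form of `x^{p³} + y^p + y^{p+1}` -/

/-- **The bent form `G`** of `F = x^{p³} + y^p + y^{p+1}`: `F` in the coordinates `(x, y − x^{p²} − x^{p²+p} − x^{p²+p+1})`,
fifteen monomials `x^i y^j` (the monomial `x^{p³+2p²+p}` occurs twice, i.e. with coefficient `2`).
[cite: CossartJannsenSaito2020, Def. 8.2 / Thm. 8.16 (p. 121) (the prepared form after y ↦ y + q(u))]
[cite: Hauser2010, §D (p. 12)] -/
def bentForm₃ (k : Type*) [Field k] (p : ℕ) : MvPolynomial (Fin 2) k :=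
  X 0 ^ 0 * X 1 ^ p + X 0 ^ 0 * X 1 ^ (p + 1) + X 0 ^ (p ^ 3 + p ^ 2 + p + 1) * X 1 ^ 0
    + X 0 ^ (p ^ 3 + 2 * p ^ 2) * X 1 ^ 0 + X 0 ^ (p ^ 3 + 2 * p ^ 2 + p) * X 1 ^ 0
    + X 0 ^ (p ^ 3 + 2 * p ^ 2 + p) * X 1 ^ 0 + X 0 ^ (p ^ 3 + 2 * p ^ 2 + p + 1) * X 1 ^ 0
    + X 0 ^ (p ^ 3 + 2 * p ^ 2 + 2 * p) * X 1 ^ 0 + X 0 ^ (p ^ 3 + 2 * p ^ 2 + 2 * p + 1) * X 1 ^ 0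
    - (X 0 ^ (p ^ 2) * X 1 ^ p + X 0 ^ (p ^ 2 + p) * X 1 ^ p + X 0 ^ (p ^ 2 + p + 1) * X 1 ^ p
      + X 0 ^ (p ^ 3) * X 1 ^ 1 + X 0 ^ (p ^ 3 + p ^ 2) * X 1 ^ 1 + X 0 ^ (p ^ 3 + p ^ 2 + p) * X 1 ^ 1)

section Bending₃

variable (p : ℕ) [hp : Fact p.Prime] [CharP k p]

omit hp [CharP k p] in
/-- `y` does not occur in the shift (plumbing). [folklore] -/
private theorem one_notMem_vars_shift₂₀ :
    (1 : Fin 2) ∉ (X 0 ^ (p ^ 2) + X 0 ^ (p ^ 2 + p) + X 0 ^ (p ^ 2 + p + 1) : MvPolynomial (Fin 2) k).vars := by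
  classical
  have h10 : (1 : Fin 2) ≠ 0 := by decide
  intro h
  rcases Finset.mem_union.1 (vars_add_subset _ _ h) with h' | h'
  · rcases Finset.mem_union.1 (vars_add_subset _ _ h') with h'' | h'' <;>
      exact h10 (by simpa [vars_X] using vars_pow _ _ h'')
  · exact h10 (by simpa [vars_X] using vars_pow _ _ h')

omit [CharP k p] in
/-- The shift vanishes at the origin (plumbing). [folklore] -/
private theorem constantCoeff_shift₂₀ :
    constantCoeff (X 0 ^ (p ^ 2) + X 0 ^ (p ^ 2 + p) + X 0 ^ (p ^ 2 + p + 1) : MvPolynomial (Fin 2) k) = 0 := by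
  have hp0 : p ≠ 0 := hp.out.pos.ne'
  simp only [map_add, map_pow, constantCoeff_X, zero_pow (pow_ne_zero 2 hp0), zero_pow (Nat.succ_ne_zero _),
    zero_pow (show p ^ 2 + p ≠ 0 from fun h => hp0 (by nlinarith [Nat.pos_of_ne_zero hp0])), add_zero]

/-- **`F = x^{p³} + y^p + y^{p+1}` in the bent coordinates is `bentForm₃`**: Frobenius gives
`(y − γ)^p = y^p − γ^p`, `γ^p = x^{p³} + x^{p³+p²} + x^{p³+p²+p}` for `γ = x^{p²} + x^{p²+p} + x^{p²+p+1}`. (derived here)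
[cite: CossartJannsenSaito2020, Def. 8.2 / Thm. 8.16 (p. 121)] [cite: Hauser2010, §D (p. 12)] -/
theorem addPolyShear_symm_bending₃ :
    (addPolyShear 1 (X 0 ^ (p ^ 2) + X 0 ^ (p ^ 2 + p) + X 0 ^ (p ^ 2 + p + 1))).symm
      (X 0 ^ p ^ 3 + (X 1 ^ p + X 1 ^ (p + 1)) : MvPolynomial (Fin 2) k) = bentForm₃ k p := by
  classical
  have h01 : (0 : Fin 2) ≠ 1 := by decide
  haveI : ExpChar (MvPolynomial (Fin 2) k) p := ExpChar.prime hp.out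
  set γ : MvPolynomial (Fin 2) k := X 0 ^ (p ^ 2) + X 0 ^ (p ^ 2 + p) + X 0 ^ (p ^ 2 + p + 1) with hγ
  have hsymm1 : (addPolyShear 1 γ).symm (X 1 : MvPolynomial (Fin 2) k) = X 1 - γ := by
    rw [addPolyShear_symm_X_self₂₀, killVar_eq_self_of_notMem (one_notMem_vars_shift₂₀ (k := k) p)]
  have hsymm0 : (addPolyShear 1 γ).symm (X 0 : MvPolynomial (Fin 2) k) = X 0 :=
    addPolyShear_symm_X_of_ne₂₀ 1 _ h01
  have hγp : γ ^ p = X 0 ^ (p ^ 2 * p) + X 0 ^ ((p ^ 2 + p) * p) + X 0 ^ ((p ^ 2 + p + 1) * p) := by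
    rw [hγ, add_pow_expChar, add_pow_expChar, ← pow_mul, ← pow_mul, ← pow_mul]
  rw [map_add, map_add, map_pow, map_pow, map_pow, hsymm0, hsymm1, pow_succ (X 1 - γ) p, sub_pow_expChar, hγp, hγ,
    bentForm₃]
  ring

/-- **The bent centre is admissible for `x^{p³} + y^p + y^{p+1}`**: weights `1/p` on `y`, `1/(p³+p²+p+1)` on `x`; all
fifteen monomials of the bent form have weight `≥ 1` (with equality at `y^p` and `x^{p³+p²+p+1}`). (derived here)
[cite: AbramovichTemkinWlodarczyk2024, Thm. 5.3.1 (2) (p. 1578), Lemma 5.2.6 (p. 1576)] [cite: Hauser2010, §C–§D (pp. 9–12)] -/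
theorem isCentreFor_bending₃ :
    IsCentreFor (X 0 ^ p ^ 3 + (X 1 ^ p + X 1 ^ (p + 1)) : MvPolynomial (Fin 2) k)
      (addPolyShear 1 (X 0 ^ (p ^ 2) + X 0 ^ (p ^ 2 + p) + X 0 ^ (p ^ 2 + p + 1)))
      (singleWeights (1 : Fin 2) p + singleWeights (0 : Fin 2) (p ^ 3 + p ^ 2 + p + 1)) := by
  classical
  have hp0 : 0 < p := hp.out.pos
  have hp2 : 2 ≤ p := hp.out.two_le
  have hA : p + 1 ≤ p ^ 2 := by nlinarith
  have h10 : (1 : Fin 2) ≠ 0 := by decide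
  have hF := addPolyShear_symm_bending₃ (k := k) p
  rw [bentForm₃] at hF
  refine ⟨constantCoeff_addPolyShear_X 1 (constantCoeff_shift₂₀ (k := k) p), fun x => ?_, ?_⟩
  · simp only [Pi.add_apply, singleWeights]
    split_ifs <;> positivity
  · rw [hF, isAdmissibleFor_iff_le_monomialOrd _ (fun i : Fin 2 => if i = 0 then p else p ^ 3 + p ^ 2 + p + 1)
      (N := p * (p ^ 3 + p ^ 2 + p + 1)) (by positivity) (scaled_singleWeights_add₂₀ p _ hp0 (by positivity))]
    refine le_monomialOrd_sub₂₀ _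
      (le_monomialOrd_add₂₀ _ (le_monomialOrd_add₂₀ _ (le_monomialOrd_add₂₀ _ (le_monomialOrd_add₂₀ _
        (le_monomialOrd_add₂₀ _ (le_monomialOrd_add₂₀ _ (le_monomialOrd_add₂₀ _ (le_monomialOrd_add₂₀ _ ?_ ?_) ?_)
          ?_) ?_) ?_) ?_) ?_) ?_)
      (le_monomialOrd_add₂₀ _ (le_monomialOrd_add₂₀ _ (le_monomialOrd_add₂₀ _ (le_monomialOrd_add₂₀ _
        (le_monomialOrd_add₂₀ _ ?_ ?_) ?_) ?_) ?_) ?_)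
    all_goals
      rw [monomialOrd_X_pow_mul_X_pow₂₀]
      simp only [↓reduceIte, if_neg h10]
      exact_mod_cast by nlinarith [hp0, hA]

/-- **`(p, p³ + p² + p + 1) ∈ W(x^{p³} + y^p + y^{p+1})`** in characteristic `p`. (derived here)
[cite: AbramovichTemkinWlodarczyk2024, Thm. 5.3.1 (2) (p. 1578)] [cite: Hauser2010, §C (p. 9)] -/
theorem bending₃_mem_admissibleInvariants :
    [(p : ℚ), ((p ^ 3 + p ^ 2 + p + 1 : ℕ) : ℚ)] ∈
      admissibleInvariants (X 0 ^ p ^ 3 + (X 1 ^ p + X 1 ^ (p + 1)) : MvPolynomial (Fin 2) k) := by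
  have hp0 : 0 < p := hp.out.pos
  have hle : (p : ℚ) ≤ ((p ^ 3 + p ^ 2 + p + 1 : ℕ) : ℚ) := by
    exact_mod_cast (Nat.le_add_left p (p ^ 3 + p ^ 2)).trans (Nat.le_succ _)
  have h := exps_mem_admissibleInvariants (isCentreFor_bending₃ (k := k) p)
  rwa [exps_singleWeights_add₂₀ hp0 (by positivity) hle] at h

/-! ## §4 Order, initial form and `δ` of the bent form -/

omit [CharP k p] in
/-- `ord (x^{p³} + y^p + y^{p+1}) = p`. (derived here) [cite: AbramovichTemkinWlodarczyk2024, §5.1 (p. 1575) (a₁ = ord)] -/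
theorem monomialOrd_F_bending₃ :
    monomialOrd (fun _ => 1) (X 0 ^ p ^ 3 + (X 1 ^ p + X 1 ^ (p + 1)) : MvPolynomial (Fin 2) k) = p := by
  classical
  have hp0 : 0 < p := hp.out.pos
  have hpp : p ≤ p ^ 3 := Nat.le_self_pow three_ne_zero p
  apply le_antisymm
  · have hn1 : ¬ (Finsupp.single (0 : Fin 2) (p ^ 3) = Finsupp.single 1 p) := fun h => by
      have h1 := DFunLike.congr_fun h 1
      rw [Finsupp.single_apply, Finsupp.single_apply, if_neg (show (0 : Fin 2) ≠ 1 by decide), if_pos rfl] at h1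
      omega
    have hn3 : ¬ (Finsupp.single (1 : Fin 2) (p + 1) = Finsupp.single 1 p) := fun h => by
      have := Finsupp.single_injective _ h
      omega
    have hmem : Finsupp.single (1 : Fin 2) p ∈
        (X 0 ^ p ^ 3 + (X 1 ^ p + X 1 ^ (p + 1)) : MvPolynomial (Fin 2) k).support := by
      rw [mem_support_iff, coeff_add, coeff_add, coeff_X_pow, coeff_X_pow, coeff_X_pow, if_neg hn1, if_pos rfl,
        if_neg hn3]
      norm_num
    refine (monomialOrd_le_weight (fun _ => 1) hmem).trans (le_of_eq ?_)
    rw [Finsupp.weight_single, smul_eq_mul, mul_one]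
  · refine le_monomialOrd_add₂₀ _ ?_ (le_monomialOrd_add₂₀ _ ?_ ?_) <;>
      rw [monomialOrd_X_pow₂₀, mul_one] <;> exact_mod_cast by omega

/-- **`ord (bentForm₃) = p`** (order is unchanged by the origin-fixing coordinate change). (derived here)
[cite: AbramovichTemkinWlodarczyk2024, Lemma 5.2.10 (p. 1577)] -/
theorem monomialOrd_bentForm₃ : monomialOrd (fun _ => 1) (bentForm₃ k p) = p := by
  rw [← addPolyShear_symm_bending₃, monomialOrd_one_symm_eq _ (isCentreFor_bending₃ (k := k) p).1,
    monomialOrd_F_bending₃]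

omit [CharP k p] in
/-- **`in_p(bentForm₃) = y^p`**. (derived here) [cite: CossartJannsenSaito2020, Def. 8.2 (1) (pp. 117–118)] -/
theorem homogeneousComponent_bentForm₃ : homogeneousComponent p (bentForm₃ k p) = X 1 ^ p := by
  classical
  have hp2 : 2 ≤ p := hp.out.two_le
  have hA : p + 2 ≤ p ^ 2 := by nlinarith
  have hB : p ^ 2 ≤ p ^ 3 := Nat.pow_le_pow_right hp.out.pos (by norm_num)
  have hc : ∀ i j : ℕ, homogeneousComponent p (X 0 ^ i * X 1 ^ j : MvPolynomial (Fin 2) k) =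
      if p = i + j then X 0 ^ i * X 1 ^ j else 0 := fun i j =>
    homogeneousComponent_of_mem ((isHomogeneous_X_pow (0 : Fin 2) i).mul (isHomogeneous_X_pow 1 j))
  simp only [bentForm₃, map_add, map_sub, hc]
  -- (the monomial `x^{p³+2p²+p}` occurs twice; one `if_neg` rewrites both occurrences)
  rw [if_pos (zero_add p).symm, if_neg (by omega), if_neg (by omega), if_neg (by omega), if_neg (by omega),
    if_neg (by omega), if_neg (by omega), if_neg (by omega), if_neg (by omega), if_neg (by omega), if_neg (by omega),
    if_neg (by omega), if_neg (by omega), if_neg (by omega)]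
  simp

omit hp [CharP k p] in
/-- The exponents of the bent form. (plumbing) [folklore] -/
private theorem mem_support_bentForm₃ {d : Fin 2 →₀ ℕ} (hd : d ∈ (bentForm₃ k p).support) :
    d = Finsupp.single 0 0 + Finsupp.single 1 p ∨ d = Finsupp.single 0 0 + Finsupp.single 1 (p + 1) ∨
    d = Finsupp.single 0 (p ^ 3 + p ^ 2 + p + 1) + Finsupp.single 1 0 ∨
    d = Finsupp.single 0 (p ^ 3 + 2 * p ^ 2) + Finsupp.single 1 0 ∨
    d = Finsupp.single 0 (p ^ 3 + 2 * p ^ 2 + p) + Finsupp.single 1 0 ∨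
    d = Finsupp.single 0 (p ^ 3 + 2 * p ^ 2 + p + 1) + Finsupp.single 1 0 ∨
    d = Finsupp.single 0 (p ^ 3 + 2 * p ^ 2 + 2 * p) + Finsupp.single 1 0 ∨
    d = Finsupp.single 0 (p ^ 3 + 2 * p ^ 2 + 2 * p + 1) + Finsupp.single 1 0 ∨
    d = Finsupp.single 0 (p ^ 2) + Finsupp.single 1 p ∨ d = Finsupp.single 0 (p ^ 2 + p) + Finsupp.single 1 p ∨
    d = Finsupp.single 0 (p ^ 2 + p + 1) + Finsupp.single 1 p ∨
    d = Finsupp.single 0 (p ^ 3) + Finsupp.single 1 1 ∨ d = Finsupp.single 0 (p ^ 3 + p ^ 2) + Finsupp.single 1 1 ∨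
    d = Finsupp.single 0 (p ^ 3 + p ^ 2 + p) + Finsupp.single 1 1 := by
  classical
  have h1 : ∀ {i j : ℕ} {d : Fin 2 →₀ ℕ}, d ∈ (X 0 ^ i * X 1 ^ j : MvPolynomial (Fin 2) k).support →
      d = Finsupp.single 0 i + Finsupp.single 1 j := fun hd =>
    Finset.mem_singleton.1 (support_X_pow_mul_X_pow₂₀ _ _ hd)
  unfold bentForm₃ at hd
  rcases Finset.mem_union.1 (support_sub _ _ _ hd) with hd | hd
  · rcases Finset.mem_union.1 (support_add hd) with hd | h9
    · rcases Finset.mem_union.1 (support_add hd) with hd | h8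
      · rcases Finset.mem_union.1 (support_add hd) with hd | h7
        · rcases Finset.mem_union.1 (support_add hd) with hd | h6
          · rcases Finset.mem_union.1 (support_add hd) with hd | h5
            · rcases Finset.mem_union.1 (support_add hd) with hd | h4
              · rcases Finset.mem_union.1 (support_add hd) with hd | h3
                · rcases Finset.mem_union.1 (support_add hd) with h1' | h2
                  · exact Or.inl (h1 h1')
                  · exact Or.inr (Or.inl (h1 h2))
                · exact Or.inr (Or.inr (Or.inl (h1 h3)))
              · exact Or.inr (Or.inr (Or.inr (Or.inl (h1 h4))))
            · exact Or.inr (Or.inr (Or.inr (Or.inr (Or.inl (h1 h5)))))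
          · exact Or.inr (Or.inr (Or.inr (Or.inr (Or.inl (h1 h6)))))
        · exact Or.inr (Or.inr (Or.inr (Or.inr (Or.inr (Or.inl (h1 h7))))))
      · exact Or.inr (Or.inr (Or.inr (Or.inr (Or.inr (Or.inr (Or.inl (h1 h8)))))))
    · exact Or.inr (Or.inr (Or.inr (Or.inr (Or.inr (Or.inr (Or.inr (Or.inl (h1 h9))))))))
  · rcases Finset.mem_union.1 (support_add hd) with hd | h15
    · rcases Finset.mem_union.1 (support_add hd) with hd | h14
      · rcases Finset.mem_union.1 (support_add hd) with hd | h13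
        · rcases Finset.mem_union.1 (support_add hd) with hd | h12
          · rcases Finset.mem_union.1 (support_add hd) with h10' | h11
            · exact Or.inr (Or.inr (Or.inr (Or.inr (Or.inr (Or.inr (Or.inr (Or.inr (Or.inl (h1 h10')))))))))
            · exact Or.inr (Or.inr (Or.inr (Or.inr (Or.inr (Or.inr (Or.inr (Or.inr (Or.inr (Or.inl (h1 h11))))))))))
          · exact Or.inr (Or.inr (Or.inr (Or.inr (Or.inr (Or.inr (Or.inr (Or.inr (Or.inr (Or.inr
              (Or.inl (h1 h12)))))))))))
        · exact Or.inr (Or.inr (Or.inr (Or.inr (Or.inr (Or.inr (Or.inr (Or.inr (Or.inr (Or.inr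
            (Or.inr (Or.inl (h1 h13))))))))))))
      · exact Or.inr (Or.inr (Or.inr (Or.inr (Or.inr (Or.inr (Or.inr (Or.inr (Or.inr (Or.inr
          (Or.inr (Or.inr (Or.inl (h1 h14)))))))))))))
    · exact Or.inr (Or.inr (Or.inr (Or.inr (Or.inr (Or.inr (Or.inr (Or.inr (Or.inr (Or.inr
        (Or.inr (Or.inr (Or.inr (h1 h15)))))))))))))

omit [CharP k p] in
/-- The vertex `x^{p³+p²+p+1}` is a monomial of the bent form (coefficient `1`). (plumbing) [folklore] -/
private theorem vertex_mem_support_bentForm₃ :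
    Finsupp.single 0 (p ^ 3 + p ^ 2 + p + 1) + Finsupp.single 1 0 ∈ (bentForm₃ k p).support := by
  classical
  have hp2 : 2 ≤ p := hp.out.two_le
  have hA : p + 2 ≤ p ^ 2 := by nlinarith
  have hB : p ^ 2 ≤ p ^ 3 := Nat.pow_le_pow_right hp.out.pos (by norm_num)
  have hne : ∀ i j : ℕ, ¬ (i = p ^ 3 + p ^ 2 + p + 1 ∧ j = 0) →
      ¬ ((Finsupp.single (0 : Fin 2) i + Finsupp.single 1 j : Fin 2 →₀ ℕ) =
          Finsupp.single 0 (p ^ 3 + p ^ 2 + p + 1) + Finsupp.single 1 0) := fun i j h h' => h (e_eq_e_iff₂₀.1 h')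
  rw [mem_support_iff]
  unfold bentForm₃
  simp only [coeff_add, coeff_sub, coeff_X_pow_mul_X_pow₂₀, if_true,
    if_neg (hne 0 p fun h => by obtain ⟨h1, h2⟩ := h; omega),
    if_neg (hne 0 (p + 1) fun h => by obtain ⟨h1, h2⟩ := h; omega),
    if_neg (hne (p ^ 3 + 2 * p ^ 2) 0 fun h => by obtain ⟨h1, h2⟩ := h; omega),
    if_neg (hne (p ^ 3 + 2 * p ^ 2 + p) 0 fun h => by obtain ⟨h1, h2⟩ := h; omega),
    if_neg (hne (p ^ 3 + 2 * p ^ 2 + p + 1) 0 fun h => by obtain ⟨h1, h2⟩ := h; omega),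
    if_neg (hne (p ^ 3 + 2 * p ^ 2 + 2 * p) 0 fun h => by obtain ⟨h1, h2⟩ := h; omega),
    if_neg (hne (p ^ 3 + 2 * p ^ 2 + 2 * p + 1) 0 fun h => by obtain ⟨h1, h2⟩ := h; omega),
    if_neg (hne (p ^ 2) p fun h => by obtain ⟨h1, h2⟩ := h; omega),
    if_neg (hne (p ^ 2 + p) p fun h => by obtain ⟨h1, h2⟩ := h; omega),
    if_neg (hne (p ^ 2 + p + 1) p fun h => by obtain ⟨h1, h2⟩ := h; omega),
    if_neg (hne (p ^ 3) 1 fun h => by obtain ⟨h1, h2⟩ := h; omega),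
    if_neg (hne (p ^ 3 + p ^ 2) 1 fun h => by obtain ⟨h1, h2⟩ := h; omega),
    if_neg (hne (p ^ 3 + p ^ 2 + p) 1 fun h => by obtain ⟨h1, h2⟩ := h; omega)]
  norm_num

omit [CharP k p] in
/-- **`δ(bentForm₃; x; y) = (p³ + p² + p + 1)/p`**: over the monomials `y^B x^A` with `|B| < p` — the six pure powers
of `x` (`|B| = 0`, values `A/p ≥ K/p`) and `y x^{p³}, y x^{p³+p²}, y x^{p³+p²+p}` (`|B| = 1`, values `A/(p−1) ≥ p³/(p−1)
> K/p` since `(p − 1) K = p⁴ − 1 < p⁴`) — the minimum is attained exactly at the vertex `x^K`. (derived here)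
[cite: CossartJannsenSaito2020, Def. 8.1 (3) / Def. 8.2 (1) (pp. 117–118)] -/
theorem hironakaDelta_bentForm₃ :
    hironakaDelta ({1} : Finset (Fin 2)) p (bentForm₃ k p) =
      ((((p ^ 3 + p ^ 2 + p + 1 : ℕ) : ℚ) / (p : ℚ) : ℚ) : WithTop ℚ) := by
  classical
  have hp0 : 0 < p := hp.out.pos
  have hp1 : 1 < p := hp.out.one_lt
  have hp2 : 2 ≤ p := hp.out.two_le
  have hA : p + 2 ≤ p ^ 2 := by nlinarith
  have hpq : (1 : ℚ) < p := by exact_mod_cast hp1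
  have hp0q : (0 : ℚ) < p := by exact_mod_cast hp0
  have hpsub : (((p - 1 : ℕ) : ℚ)) = (p : ℚ) - 1 := by rw [Nat.cast_sub hp1.le, Nat.cast_one]
  have hK : ((p : ℚ) - 1) * ((p ^ 3 + p ^ 2 + p + 1 : ℕ) : ℚ) = (p : ℚ) ^ 4 - 1 := by push_cast; ring
  apply le_antisymm
  · unfold hironakaDelta
    refine (Finset.inf_le (Finset.mem_filter.2 ⟨vertex_mem_support_bentForm₃ (k := k) p, ?_⟩)).trans (le_of_eq ?_)
    · rw [blockDeg_singleton, e_apply_one₂₀]; exact hp0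
    · rw [coDeg_singleton, blockDeg_singleton, degree_e₂₀, e_apply_one₂₀, Nat.add_zero, Nat.sub_zero, Nat.sub_zero]
  · rw [le_hironakaDelta_iff]
    intro d hd hb
    rw [blockDeg_singleton] at hb
    rw [coDeg_singleton, blockDeg_singleton]
    rcases mem_support_bentForm₃ (k := k) p hd with
        rfl | rfl | rfl | rfl | rfl | rfl | rfl | rfl | rfl | rfl | rfl | rfl | rfl | rfl <;>
      rw [e_apply_one₂₀] at hb ⊢ <;> (try omega) <;> rw [degree_e₂₀]
    · rw [Nat.add_zero, Nat.sub_zero, Nat.sub_zero]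
    · rw [Nat.add_zero, Nat.sub_zero, Nat.sub_zero, div_le_div_iff_of_pos_right hp0q]
      exact_mod_cast (by omega : p ^ 3 + p ^ 2 + p + 1 ≤ p ^ 3 + 2 * p ^ 2)
    · rw [Nat.add_zero, Nat.sub_zero, Nat.sub_zero, div_le_div_iff_of_pos_right hp0q]
      exact_mod_cast (by omega : p ^ 3 + p ^ 2 + p + 1 ≤ p ^ 3 + 2 * p ^ 2 + p)
    · rw [Nat.add_zero, Nat.sub_zero, Nat.sub_zero, div_le_div_iff_of_pos_right hp0q]
      exact_mod_cast (by omega : p ^ 3 + p ^ 2 + p + 1 ≤ p ^ 3 + 2 * p ^ 2 + p + 1)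
    · rw [Nat.add_zero, Nat.sub_zero, Nat.sub_zero, div_le_div_iff_of_pos_right hp0q]
      exact_mod_cast (by omega : p ^ 3 + p ^ 2 + p + 1 ≤ p ^ 3 + 2 * p ^ 2 + 2 * p)
    · rw [Nat.add_zero, Nat.sub_zero, Nat.sub_zero, div_le_div_iff_of_pos_right hp0q]
      exact_mod_cast (by omega : p ^ 3 + p ^ 2 + p + 1 ≤ p ^ 3 + 2 * p ^ 2 + 2 * p + 1)
    · rw [Nat.add_sub_cancel, hpsub, div_le_div_iff₀ hp0q (by linarith)]
      push_cast
      nlinarith [hK]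
    · rw [Nat.add_sub_cancel, hpsub, div_le_div_iff₀ hp0q (by linarith)]
      push_cast
      nlinarith [hK]
    · rw [Nat.add_sub_cancel, hpsub, div_le_div_iff₀ hp0q (by linarith)]
      push_cast
      nlinarith [hK]

omit [CharP k p] in
/-- **`bentForm₃` is `δ`-prepared** (vacuously: `p ∤ p³ + p² + p + 1`). (derived here)
[cite: CossartJannsenSaito2020, Def. 8.8 / Thm. 8.16 (pp. 119–121)] -/
theorem isDeltaPrepared_bentForm₃ : IsDeltaPrepared ({1} : Finset (Fin 2)) p (bentForm₃ k p) := by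
  refine isDeltaPrepared_of_hironakaDelta_eq_div hp.out.pos (hironakaDelta_bentForm₃ (k := k) p) fun hdvd => ?_
  have h1 : p ∣ 1 := (Nat.dvd_add_right ⟨p ^ 2 + p + 1, by ring⟩).1 hdvd
  exact hp.out.one_lt.ne' (Nat.dvd_one.1 h1)

/-! ## §5 Maximality: `max W(x^{p³} + y^p + y^{p+1}) = (p, p³ + p² + p + 1)` -/

/-- `W(bentForm₃) = W(x^{p³} + y^p + y^{p+1})` (origin-fixing coordinate change). (derived here)
[cite: AbramovichTemkinWlodarczyk2024, Thm. 1.1.1 (3) (p. 1562) (functoriality)] -/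
theorem admissibleInvariants_bentForm₃ :
    admissibleInvariants (bentForm₃ k p) =
      admissibleInvariants (X 0 ^ p ^ 3 + (X 1 ^ p + X 1 ^ (p + 1)) : MvPolynomial (Fin 2) k) := by
  rw [← addPolyShear_symm_bending₃]
  exact admissibleInvariants_map_eq _
    (constantCoeff_symm_X_eq_zero_of_forall _ (isCentreFor_bending₃ (k := k) p).1) _

/-- **Upper bound: no invariant of `x^{p³} + y^p + y^{p+1}` exceeds `(p, p³ + p² + p + 1)`** (the two-variable vertex
bound applied to the `δ`-prepared bent form). (derived here) [cite: CossartJannsenSaito2020, Thm. 8.16 (p. 121)]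
[cite: AbramovichTemkinWlodarczyk2024, Thm. 5.1.1 / §5.3 (pp. 1575–1578)] -/
theorem not_lt_of_mem_admissibleInvariants_bending₃ {c : List ℚ}
    (hc : c ∈ admissibleInvariants (X 0 ^ p ^ 3 + (X 1 ^ p + X 1 ^ (p + 1)) : MvPolynomial (Fin 2) k)) :
    ¬ ATW.TruncLex.lt [(p : ℚ), ((p ^ 3 + p ^ 2 + p + 1 : ℕ) : ℚ)] c := by
  rw [← admissibleInvariants_bentForm₃] at hc
  exact not_lt_of_mem_admissibleInvariants_of_vertex₂ hp.out.pos (monomialOrd_bentForm₃ (k := k) p)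
    (homogeneousComponent_bentForm₃ (k := k) p) (hironakaDelta_bentForm₃ (k := k) p)
    (isDeltaPrepared_bentForm₃ (k := k) p) hc

/-- **`max W(x^{p³} + y^p + y^{p+1}) = (p, p³ + p² + p + 1)`** in characteristic `p`, over all admissible centres after
all polynomial coordinate changes — the third rung `(p, (p⁴ − 1)/(p − 1))` of the bending ladder. (derived here)
[cite: CossartJannsenSaito2020, Thm. 8.16 (p. 121)] [cite: Hauser2010, §C (p. 9) and §D (p. 12)]
[cite: HauserPerlega2019PRIMS, §7 (p. 798)] -/
theorem isMaxInv_bending₃ :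
    IsMaxInv (admissibleInvariants (X 0 ^ p ^ 3 + (X 1 ^ p + X 1 ^ (p + 1)) : MvPolynomial (Fin 2) k))
      [(p : ℚ), ((p ^ 3 + p ^ 2 + p + 1 : ℕ) : ℚ)] :=
  ⟨bending₃_mem_admissibleInvariants p, fun _ hc => not_lt_of_mem_admissibleInvariants_bending₃ p hc⟩

end Bending₃

/-! ## §6 Characteristic `2`: `max W(x⁸ + y² + y³) = (2, 15)` -/

/-- **`max W(x⁸ + y² + y³) = (2, 15)` in characteristic `2`** (the split law offers at most `(2, 8)`; the `e = 2`
rung is `max W(x⁴ + y² + y³) = (2, 7)`). (derived here) [cite: Hauser2010, §C (p. 9) and §D (p. 12)]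
[cite: CossartJannsenSaito2020, Thm. 8.16 (p. 121)] -/
theorem isMaxInv_bending₃_two [CharP k 2] :
    IsMaxInv (admissibleInvariants (X 0 ^ 8 + (X 1 ^ 2 + X 1 ^ 3) : MvPolynomial (Fin 2) k)) [(2 : ℚ), 15] := by
  haveI : Fact (Nat.Prime 2) := ⟨Nat.prime_two⟩
  have h := isMaxInv_bending₃ (k := k) 2
  norm_num at h
  exact h

end WeightedBlowup

end Literature.AlgebraicGeometry.Resolution
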